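import Summits.HodgeConjecture.HodgeConjecture.Theorems.NikulinTwinTransportRealMultiplicationSqrtTwoAlgebraic
import Literature.AlgebraicGeometry.HodgeTheory.AlgebraicClassesExteriorProduct
import Literature.AlgebraicTopology.SingularHomology.CupProductProofs

/-!
# Route NikulinTwinTransport · `RealMultiplicationSqrtTwoAlgebraic` (stmt-HodgeConjecture-13679) —
# divisor correspondences from fibre integration

The reduction `realMultiplicationSqrtTwoAlgebraic_of_twinSimilitudeAlgebraic` (sibling file
`NikulinTwinTransportRealMultiplicationSqrtTwoAlgebraic`) takes as its one inline formal debt the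
DIVISOR-CORRESPONDENCE hypothesis (D): for algebraic divisor classes `a, b` on a projective K3
surface `S` some algebraic `γ ∈ N²H⁴(S × S)` acts as the rank-one map `x ↦ (x.a) b`. This file
discharges (D) from the Gysin calculus already PROVED in the tree — the projection formula
`complexGysin_cup`, associativity / graded commutativity / naturality of the cup product
(`cupProduct_assoc`, `cupProduct_gradedComm_holds`, `cupProduct_map`, `cupProduct_one`) and the
algebraicity of exterior products (`cupProduct_map_fst_map_snd_mem_algebraicClasses`) — modulo ONE
smaller and more basic statement, FIBRE INTEGRATION (FI): `pr_{1*}(pr_2^* p) = c · 1_S`, `c ≠ 0`,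
for the integral generator `p` of `H⁴(S(ℂ))` (= the base change `pr_2^* ι_* = s_* π^*` for the
product square over a point, plus `H⁴(S(ℂ); ℂ) = ℂ · [pt]`; Fulton, *Young Tableaux*, App. B;
Fulton–MacPherson). The class is `γ = c⁻¹ · pr_1^* b ∪ pr_2^* a` (`= b × a` up to the constant):
`pr_{1*}(pr_2^* x ∪ pr_1^* b ∪ pr_2^* a) = pr_{1*}(pr_1^* b ∪ pr_2^*(x ∪ a)) = b ∪ pr_{1*} pr_2^*(t p)
= t c · b` (`divisorCorrespondence_of_fibreIntegral`). Consequences, with (FI) in place of (D):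
`realMultiplicationSqrtTwoAlgebraic_of_fibreIntegral` (item 13679's decl from X + the three named
facts + (FI)), `realMultiplicationGlue_of_fibreIntegral` (item 13681's decl from the facts + (FI)),
`assembly_of_squareGlue_of_fibreIntegral` (item 13942's decl from `SquareGlue` + facts + (FI)).
(FI) is also exactly what the composition of correspondences (Buskin's Lemma 6.3, the hypothesis
`hC` of `twinSimilitudeAlgebraic_of_anchor`) needs from the missing Gysin base change; it is NOT
proved here (no Künneth / base change for `S(ℂ) × S(ℂ)` in the tree).
Prover seat prover-HodgeConjecture-route-HodgeConjecture-NikulinTwinTransport-3.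
-/

noncomputable section

namespace Summit.HodgeConjecture.HodgeConjecture.Theorems.NikulinTwinTransport

open scoped Manifold
open CategoryTheory MonoidalCategory SemiCartesianMonoidalCategory
open Literature.AlgebraicGeometry.Motives Literature.AlgebraicGeometry.HodgeTheory
open Literature.AlgebraicGeometry.Surfaces Literature.Geometry.Kaehler
open Literature.AlgebraicTopology.SingularHomology

/-- The exterior product `pr_1^* a ∪ pr_2^* b` of two algebraic divisor classes is an algebraic
class of codimension `2` — `cupProduct_map_fst_map_snd_mem_algebraicClasses` with the degree
bookkeeping `1 + 1 = k` made explicit, so that the numeral `2` can be used downstream.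
[cite: VoisinHodgeII2003, proof of Prop. 9.20] -/
theorem cupProduct_fst_snd_mem_algebraicClasses_of_eq {d d' : ℕ} {V V' : SchemeOver ℂ}
    (hV : IsSmoothProjective d V) (hV' : IsSmoothProjective d' V')
    {a : complexBetti V (2 * 1)} {b : complexBetti V' (2 * 1)}
    (ha : a ∈ algebraicClasses V 1) (hb : b ∈ algebraicClasses V' 1) {k : ℕ} (hk : 1 + 1 = k)
    (h : 2 * 1 + 2 * 1 = 2 * k) :
    cupProduct h (complexBetti.map (fst V V') (2 * 1) a) (complexBetti.map (snd V V') (2 * 1) b) ∈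
      algebraicClasses (V ⊗ V') k := by
  subst hk
  exact cupProduct_map_fst_map_snd_mem_algebraicClasses hV hV' ha hb

/-- **Divisor correspondences from integration over the fibre.** If, for a projective K3 surface
`S` with integral generator `p` of `H⁴`, the Gysin map of the first projection integrates the
pulled-back point class to a non-zero constant, `pr_{1*}(pr_2^* p) = c · 1_S` with `c ≠ 0` (base
change for the product square over the point, Fulton–MacPherson; App. B (B4)), then for all
algebraic divisor classes `a, b ∈ N¹H²(S)` the class `γ = c⁻¹ · pr_1^* b ∪ pr_2^* a` — algebraic by
`cupProduct_map_fst_map_snd_mem_algebraicClasses` — acts as the rank-one map `x ↦ (x.a) b`: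
`pr_{1*}(pr_2^* x ∪ γ) = t · b` whenever `x ∪ a = t · p` (projection formula `complexGysin_cup`,
associativity, graded commutativity and naturality of `∪`). [cite: Fulton1998, §16.1]
[cite: FultonYoungTableaux1997, Appendix B §B.1 (3), (6)] -/
theorem divisorCorrespondence_of_fibreIntegral (μ : OrientationFamily) (hμ : μ.HasPoincareDuality)
    (S : SchemeOver ℂ)
    (hS : (IsSmoothProjective 2 S ∧ Subsingleton (structureSheafCohomology S.left 1) ∧
      ∃ (A : HodgeModel 2 S) (η : MForm 𝓘(ℝ, A.model) A.carrier ℂ 2),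
        IsHolomorphicInCharts η ∧ ∀ x, η x ≠ 0))
    (p : complexBetti S (2 * 2)) (c : ℂ) (hc : c ≠ 0)
    (hκ : complexGysin μ (IsSmoothProjective.tensor_holds hS.1 hS.1) hS.1 (fst S S)
        (rfl : 2 * 2 + 2 * 2 = 0 + 2 * (2 + 2)) (complexBetti.map (snd S S) (2 * 2) p) =
      c • singularCohomology.one ℂ (ComplexPoints S))
    {a b : complexBetti S (2 * 1)} (ha : a ∈ algebraicClasses S 1) (hb : b ∈ algebraicClasses S 1) :
    ∃ γ ∈ algebraicClasses (S ⊗ S) 2, ∀ (x : complexBetti S (2 * 1)) (t : ℂ),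
      cupProduct (rfl : 2 * 1 + 2 * 1 = 2 * 2) x a = t • p →
        complexGysin μ (IsSmoothProjective.tensor_holds hS.1 hS.1) hS.1 (fst S S)
            (rfl : 2 * 1 + 2 * 2 + 2 * 2 = 2 * 1 + 2 * (2 + 2))
            (cupProduct (rfl : 2 * 1 + 2 * 2 = 2 * 1 + 2 * 2)
              (complexBetti.map (snd S S) (2 * 1) x) γ) = t • b := by
  -- the exterior product `γ₀ = pr_1^* b ∪ pr_2^* a`, algebraic
  set γ₀ : complexBetti (S ⊗ S) (2 * 2) := cupProduct (rfl : 2 * 1 + 2 * 1 = 2 * 2)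
    (complexBetti.map (fst S S) (2 * 1) b) (complexBetti.map (snd S S) (2 * 1) a) with hγ₀
  have hγ₀alg : γ₀ ∈ algebraicClasses (S ⊗ S) 2 :=
    cupProduct_fst_snd_mem_algebraicClasses_of_eq hS.1 hS.1 hb ha (rfl : 1 + 1 = 2) _
  refine ⟨c⁻¹ • γ₀, Submodule.smul_mem _ _ hγ₀alg, fun x t hxa => ?_⟩
  -- `pr_2^* x ∪ (pr_1^* b ∪ pr_2^* a) = pr_1^* b ∪ pr_2^* (x ∪ a) = t • (pr_1^* b ∪ pr_2^* p)`
  have hcomm : cupProduct (rfl : 2 * 1 + 2 * 1 = 2 * 2) (complexBetti.map (snd S S) (2 * 1) x)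
      (complexBetti.map (fst S S) (2 * 1) b) =
      cupProduct (rfl : 2 * 1 + 2 * 1 = 2 * 2) (complexBetti.map (fst S S) (2 * 1) b)
        (complexBetti.map (snd S S) (2 * 1) x) := by
    rw [cupProduct_gradedComm_holds ℂ _ (rfl : 2 * 1 + 2 * 1 = 2 * 2) rfl]
    norm_num
  have hnat : cupProduct (rfl : 2 * 1 + 2 * 1 = 2 * 2) (complexBetti.map (snd S S) (2 * 1) x)
      (complexBetti.map (snd S S) (2 * 1) a) = t • complexBetti.map (snd S S) (2 * 2) p := by
    rw [complexBetti.map, complexBetti.map, ← cupProduct_map, hxa, map_smul]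
  have h1 : cupProduct (rfl : 2 * 1 + 2 * 2 = 2 * 1 + 2 * 2) (complexBetti.map (snd S S) (2 * 1) x) γ₀ =
      t • cupProduct (rfl : 2 * 1 + 2 * 2 = 2 * 1 + 2 * 2) (complexBetti.map (fst S S) (2 * 1) b)
        (complexBetti.map (snd S S) (2 * 2) p) := by
    rw [hγ₀, ← cupProduct_assoc (rfl : 2 * 1 + 2 * 1 = 2 * 2) (rfl : 2 * 1 + 2 * 1 = 2 * 2)
      (rfl : 2 * 2 + 2 * 1 = 2 * 1 + 2 * 2) (rfl : 2 * 1 + 2 * 2 = 2 * 1 + 2 * 2), hcomm,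
      cupProduct_assoc (rfl : 2 * 1 + 2 * 1 = 2 * 2) (rfl : 2 * 1 + 2 * 1 = 2 * 2)
      (rfl : 2 * 2 + 2 * 1 = 2 * 1 + 2 * 2) (rfl : 2 * 1 + 2 * 2 = 2 * 1 + 2 * 2), hnat, map_smul]
  -- projection formula and `pr_{1*} pr_2^* p = c · 1`
  have h2 : complexGysin μ (IsSmoothProjective.tensor_holds hS.1 hS.1) hS.1 (fst S S)
      (rfl : 2 * 1 + 2 * 2 + 2 * 2 = 2 * 1 + 2 * (2 + 2))
      (cupProduct (rfl : 2 * 1 + 2 * 2 = 2 * 1 + 2 * 2) (complexBetti.map (fst S S) (2 * 1) b)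
        (complexBetti.map (snd S S) (2 * 2) p)) = c • b := by
    rw [complexGysin_cup hμ (IsSmoothProjective.tensor_holds hS.1 hS.1) hS.1 (fst S S)
      (rfl : 2 * 1 + 2 * 2 = 2 * 1 + 2 * 2) (rfl : 2 * 1 + 2 * 2 + 2 * 2 = 2 * 1 + 2 * (2 + 2))
      (rfl : 2 * 2 + 2 * 2 = 0 + 2 * (2 + 2)) (rfl : 2 * 1 + 0 = 2 * 1), hκ, map_smul, cupProduct_one]
  have hct : c⁻¹ * t * c = t := by field_simp
  rw [map_smul, map_smul, h1, map_smul, h2, smul_smul, smul_smul, hct]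

/-- Hypothesis (FI), FIBRE INTEGRATION for the product of a projective K3 surface with itself:
`pr_{1*}(pr_2^* p) = c · 1_S` with `c ≠ 0` for the integral generator `p` of `H⁴(S(ℂ))` — the base
change `pr_2^* ∘ ι_* = s_* ∘ π^*` for the square `(S × S; S, S; pt)` applied to `1`, together with
`H⁴(S(ℂ); ℂ) = ℂ · ι_* 1` (Fulton–MacPherson; Fulton, *Young Tableaux* App. B). It implies the
divisor-correspondence hypothesis (D) of `realMultiplicationSqrtTwoAlgebraic_of_twinSimilitudeAlgebraic`
(`divisorCorrespondence_of_fibreIntegral`), whence: **real multiplication by `√2` is algebraic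
granted X at `(S, S)`, the three named facts, and fibre integration.**
[cite: Varesco2023, Thm. 2.1 and Rem. 2.2] [cite: FultonYoungTableaux1997, Appendix B §B.1] -/
theorem realMultiplicationSqrtTwoAlgebraic_of_fibreIntegral
    (hX : Theses.NikulinTwinTransport.TwinSimilitudeAlgebraic)
    (hmark : Huybrechts_K3_marking_exists) (hHT : Huybrechts_K3_hodgeTypes_H2)
    (hN11 : ∀ (S : SchemeOver ℂ), IsK3Surface S →
      ∀ d ∈ algebraicClasses S 1, IsOfHodgeType 2 S (2 * 1) 1 1 d)
    (hFI : ∀ (μ : OrientationFamily), μ.HasPoincareDuality →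
      ∀ (S : SchemeOver ℂ)
        (hS : (IsSmoothProjective 2 S ∧ Subsingleton (structureSheafCohomology S.left 1) ∧
          ∃ (A : HodgeModel 2 S) (η : MForm 𝓘(ℝ, A.model) A.carrier ℂ 2),
            IsHolomorphicInCharts η ∧ ∀ x, η x ≠ 0))
        (p : complexBetti S (2 * 2)),
        (IsIntegralClass p ∧ ∀ q : complexBetti S (2 * 2), IsIntegralClass q → ∃ n : ℤ, q = n • p) →
        ∃ c : ℂ, c ≠ 0 ∧
          complexGysin μ (IsSmoothProjective.tensor_holds hS.1 hS.1) hS.1 (fst S S)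
              (rfl : 2 * 2 + 2 * 2 = 0 + 2 * (2 + 2)) (complexBetti.map (snd S S) (2 * 2) p) =
            c • singularCohomology.one ℂ (ComplexPoints S)) :
    Theses.NikulinTwinTransport.RealMultiplicationSqrtTwoAlgebraic := by
  refine realMultiplicationSqrtTwoAlgebraic_of_twinSimilitudeAlgebraic hX hmark hHT hN11 ?_
  intro μ hμ S hS p hp a ha b hb
  obtain ⟨c, hc, hκ⟩ := hFI μ hμ S hS p hp
  exact divisorCorrespondence_of_fibreIntegral μ hμ S hS p c hc hκ ha hb

/-- **The glue item `RealMultiplicationGlue` (stmt-HodgeConjecture-13681) from the three named facts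
and fibre integration (FI) alone** — no Buskin, no universal twin, no Lefschetz `(1,1)`, no
composition or transpose of correspondences. [cite: Varesco2023, Thm. 2.1 and Rem. 2.2] -/
theorem realMultiplicationGlue_of_fibreIntegral
    (hmark : Huybrechts_K3_marking_exists) (hHT : Huybrechts_K3_hodgeTypes_H2)
    (hG : Grothendieck1969_supportedClasses_le_hodgeConiveau)
    (hFI : ∀ (μ : OrientationFamily), μ.HasPoincareDuality →
      ∀ (S : SchemeOver ℂ)
        (hS : (IsSmoothProjective 2 S ∧ Subsingleton (structureSheafCohomology S.left 1) ∧
          ∃ (A : HodgeModel 2 S) (η : MForm 𝓘(ℝ, A.model) A.carrier ℂ 2),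
            IsHolomorphicInCharts η ∧ ∀ x, η x ≠ 0))
        (p : complexBetti S (2 * 2)),
        (IsIntegralClass p ∧ ∀ q : complexBetti S (2 * 2), IsIntegralClass q → ∃ n : ℤ, q = n • p) →
        ∃ c : ℂ, c ≠ 0 ∧
          complexGysin μ (IsSmoothProjective.tensor_holds hS.1 hS.1) hS.1 (fst S S)
              (rfl : 2 * 2 + 2 * 2 = 0 + 2 * (2 + 2)) (complexBetti.map (snd S S) (2 * 2) p) =
            c • singularCohomology.one ℂ (ComplexPoints S)) :
    Theses.NikulinTwinTransport.RealMultiplicationGlue :=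
  fun hX _ _ _ => realMultiplicationSqrtTwoAlgebraic_of_fibreIntegral hX hmark hHT
    (fun _ hS _ hd => isOfHodgeType_oneOne_of_mem_algebraicClasses hG hS hd) hFI

/-- **The frame item `Assembly` (stmt-HodgeConjecture-13942) from `SquareGlue`, the three named
facts and fibre integration (FI).** [cite: Varesco2023, Thm. 2.1 and Rem. 2.2] -/
theorem assembly_of_squareGlue_of_fibreIntegral
    (hSq : Theses.NikulinTwinTransport.SquareGlue)
    (hmark : Huybrechts_K3_marking_exists) (hHT : Huybrechts_K3_hodgeTypes_H2)
    (hG : Grothendieck1969_supportedClasses_le_hodgeConiveau)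
    (hFI : ∀ (μ : OrientationFamily), μ.HasPoincareDuality →
      ∀ (S : SchemeOver ℂ)
        (hS : (IsSmoothProjective 2 S ∧ Subsingleton (structureSheafCohomology S.left 1) ∧
          ∃ (A : HodgeModel 2 S) (η : MForm 𝓘(ℝ, A.model) A.carrier ℂ 2),
            IsHolomorphicInCharts η ∧ ∀ x, η x ≠ 0))
        (p : complexBetti S (2 * 2)),
        (IsIntegralClass p ∧ ∀ q : complexBetti S (2 * 2), IsIntegralClass q → ∃ n : ℤ, q = n • p) →
        ∃ c : ℂ, c ≠ 0 ∧
          complexGysin μ (IsSmoothProjective.tensor_holds hS.1 hS.1) hS.1 (fst S S)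
              (rfl : 2 * 2 + 2 * 2 = 0 + 2 * (2 + 2)) (complexBetti.map (snd S S) (2 * 2) p) =
            c • singularCohomology.one ℂ (ComplexPoints S)) :
    Theses.NikulinTwinTransport.Assembly :=
  fun hX _ _ h₁ h₇ => h₇ (hSq (realMultiplicationSqrtTwoAlgebraic_of_fibreIntegral hX hmark hHT
    (fun _ hS _ hd => isOfHodgeType_oneOne_of_mem_algebraicClasses hG hS hd) hFI) h₁)

end Summit.HodgeConjecture.HodgeConjecture.Theorems.NikulinTwinTransport

end
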